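import Summits.BirchSwinnertonDyer.BirchSwinnertonDyer.Theorems.ByReductionTypeAtTwoLambdaConstPinchEnd
import Summits.BirchSwinnertonDyer.Rank1Residual.X5.TwoAdicTargetsEisenstein
import Summits.BirchSwinnertonDyer.Rank1Residual.X5.TwoAdicTargetsPub
import HarnessLib

/-!
# The Kato half + `BSD(E,2)` ⇒ the FULL `2`-adic main conjecture at analytic rank `0`
# (route ByReductionTypeAtTwo, crux child `OrdKatoHalfAtTwo`, item stmt-BirchSwinnertonDyer-19150;
# seat bsd-2adic-ord-2)

HONEST FRAMING (cell `bsd-2adic`, run/shared/lean/pub/bsd-2adic/, HUMAN RULINGS D-0036/D-0074): THEOREMS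
ONLY; nothing asserted; no definition; no new named fact; closes nothing by itself. `OrdKatoHalfAtTwo`
(the ∀-closure of `X5.O1.MainConjectureLowerDivisibilityAtTwoOrd W` over non-CM, analytic-rank-`0`,
good-ordinary-at-`2` curves) is Kato's INTEGRAL divisibility at `p = 2` — not in print (Kato 2004
Thm. 17.4 (3) prints `p ≠ 2`) and not proved here.

WHAT IS PROVED (the REVERSE of the landed glue `goodOrdinaryRankZeroAtTwo_of_facts_of_halves`,
p409439, which needs BOTH halves to reach `BSD(E,2)`). The cell's `λ` + constant-term pinch
(`Theorems/ByReductionTypeAtTwoLambdaConstPinch.lean`, p413116) turns a RATIONAL divisibility + a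
`λ`-match + `BSD(E,2)` into `char_Λ X = (ϖ·L₂)`. With the INTEGRAL divisibility that the Kato half
asserts, the `λ`-match is not needed at all:

* §1 (pure `Λ`-algebra, any `p`): `L ∈ (f)`, `f(0) ≠ 0`, `‖L(0)‖ = ‖f(0)‖` ⇒ `(L) = (f)` — write
  `L = h·f`; the constant terms give `‖h(0)‖ = 1`, so `h ∈ Λˣ`.
* §2 (a cyclotomic datum of a rank-`0` good-ordinary-at-`2` curve): `L₀ ∈ char_Λ X` (the Kato half AT
  the datum, `ι L₀ = ϖ·L₂(f,α)`), `X` torsion, PUBLISHED Greenberg Thm. 4.1 at `2` (`hEC`, slot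
  `δ = 0`) and `BSD(E,2)` as the valuation identity `ord₂(L(E,1)/Ω_E) = ord₂ #Ш + ord₂ ∏c_ℓ −
  2·ord₂ #E(ℚ)_tors` ⇒ `char_Λ X = (L₀)`. The constant-term bookkeeping (interpolation
  `L₀(0) = ϖ(1 − α⁻¹)²[0]⁺_f`, `1 − α⁻¹ ~ #Ẽ(𝔽₂)(2)`, Thm. 4.1) is the one of p413116 §4, verbatim.
* §3 (consumers, per curve): PRINT {modularity, GZK, Kato 17.4 (1) at `2` (torsion only), Greenberg
  4.1 at `2`} + `BSDp W 2` + the Kato half `X5.O1.MainConjectureLowerDivisibilityAtTwoOrd W` ⇒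
  `MazurMainConjecture W 2`, hence the Eisenstein half `X5.O1.MainConjectureEisensteinDivisibilityAtTwo W`
  — with NO `λ`-certificate, NO Néron-integrality certificate `hper₀` (integrality is part of the Kato
  half), NO Greenberg Prop-5.14 point, NO isogeny transport. Conversely (bookkeeping, landed
  `mainConjectureLowerDivisibilityAtTwoOrd_of_mazurMainConjecture`) the main conjecture gives the Kato
  half, so on a rank-`0` good-ordinary curve carrying `BSD(E,2)`: Kato half ⟺ `2`-adic IMC ⟹
  Eisenstein half (`mazurMainConjecture_two_iff_katoHalfAt_of_bsdp`).

USE (class level, file `…KatoHalfPinchGlue.lean`): `OrdPublishedInputsAtTwo → OrdKatoHalfAtTwo →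
GoodOrdinaryRankZeroAtTwo → (2-adic IMC ∧ Eisenstein half at every non-CM rank-0 good-ordinary W)`;
so, given the Kato half, the parent crux `GoodOrdinaryRankZeroAtTwo` and the rank-`0` part of
`OrdEisensteinHalfAtTwo` are EQUIVALENT — the Kato half carries the whole Iwasawa-theoretic content of
the good-ordinary rank-`0` block once `BSD(·,2)` is known numerically, and vice versa.

References: K. Kato, Astérisque 295 (2004), Thm. 17.4; R. Greenberg, LNM 1716 (1999), Thm. 4.1;
B. Mazur, J. Tate, J. Teitelbaum, Invent. Math. 84 (1986), §I.14; R. L. Miller, LMS J. Comput. Math.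
14 (2011), Def. 1.1; L. Washington, *Introduction to Cyclotomic Fields*, §7.1.
-/

set_option autoImplicit false

noncomputable section

open scoped Classical MatrixGroups ModularForm

open CongruenceSubgroup WeierstrassCurve Literature.NumberTheory.EllipticCurves
  Literature.NumberTheory.EllipticCurves.ModularForms Literature.NumberTheory.EllipticCurves.Rank1Residual
  Literature.NumberTheory.EllipticCurves.Rank1Residual.Typed
  Summit.BirchSwinnertonDyer.Rank1Residual.X1.MuLambda
  Summit.BirchSwinnertonDyer.BirchSwinnertonDyer.Theorems.Rank1ResidualX1Defs

namespace Summit.BirchSwinnertonDyer.BirchSwinnertonDyer.Theorems.KatoHalfPinch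

/-! ## §1 The constant-term pinch for an INTEGRAL divisibility (pure `Λ`-algebra, any `p`) -/

variable {p : ℕ} [Fact p.Prime]

/-- **The integral constant-term pinch.** In `Λ = ℤ_p⟦T⟧`: if `L ∈ (f)`, `f(0) ≠ 0` and
`‖L(0)‖ = ‖f(0)‖`, then `(L) = (f)`. Proof: `L = h·f`, so `‖h(0)‖·‖f(0)‖ = ‖f(0)‖ ≠ 0`, `‖h(0)‖ = 1`,
`h(0) ∈ ℤ_pˣ`, `h ∈ Λˣ`. [cite: Washington1997, §7.1]
[cite: GreenbergVatsal2000, p. 4 (after Thm. (1.2))] -/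
theorem span_eq_span_of_mem_span_of_norm_constantCoeff_eq {f L : IwasawaAlgebra p}
    (hmem : L ∈ Ideal.span ({f} : Set (IwasawaAlgebra p)))
    (h0 : PowerSeries.constantCoeff f ≠ 0)
    (hnorm : ‖PowerSeries.constantCoeff L‖ = ‖PowerSeries.constantCoeff f‖) :
    Ideal.span ({L} : Set (IwasawaAlgebra p)) = Ideal.span {f} := by
  obtain ⟨h, rfl⟩ := Ideal.mem_span_singleton'.mp hmem
  rw [map_mul, norm_mul] at hnorm
  have hpos : 0 < ‖PowerSeries.constantCoeff f‖ := norm_pos_iff.mpr h0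
  have h1 : ‖PowerSeries.constantCoeff h‖ = 1 :=
    mul_right_cancel₀ hpos.ne' (hnorm.trans (one_mul _).symm)
  have hu : IsUnit h := PowerSeries.isUnit_iff_constantCoeff.mpr (PadicInt.isUnit_iff.mpr h1)
  rw [mul_comm]
  exact Ideal.span_singleton_eq_span_singleton.mpr (associated_mul_unit_right f h hu).symm

/-! ## §2 `char_Λ X = (L₀)` at a rank-`0` datum from `L₀ ∈ char_Λ X` + Greenberg 4.1@2 + `BSD(E,2)` -/

section Curve

variable (W : WeierstrassCurve ℚ) [W.IsElliptic] [W.IsGloballyMinimal]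
  {N : ℕ} [NeZero N] {f : CuspForm (Gamma0 N) 2}

/-- **The `2`-adic main conjecture at a cyclotomic datum of a rank-`0` good-ordinary-at-`2` curve from
the Kato half AT THE DATUM and `BSD(E,2)` — no `λ`-input, no rational divisibility.** `W` globally
minimal, good ordinary at `2`, `L(E,1) ≠ 0`, `Ш` finite, `X` torsion (`hX`); PUBLISHED input Greenberg
1999 Thm. 4.1 at `2` (`hEC`, slot `δ = 0`); `ι L₀ = ϖ·L₂(f,α)` with `ϖ·Ω_E = Ω⁺_f`; the Kato half at the
datum `L₀ ∈ char_Λ X` (`hmem`); and `BSD(E,2)` as the EQUALITY `ord₂(L(E,1)/Ω_E) = ord₂ #Ш + ord₂ ∏c_ℓ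
− 2·ord₂ #E(ℚ)_tors` (`hbsd`). Then `char_Λ X = (L₀)`: interpolation, `1 − α⁻¹ ~ #Ẽ(𝔽₂)(2)`, Thm. 4.1
and `hbsd` give `‖L₀(0)‖ = ‖f_E(0)‖ ≠ 0` exactly as in p413116 §4; conclude by §1.
[cite: GreenbergLNM1716, Thm. 4.1 (p. 102)] [cite: MazurTateTeitelbaum1986Invent, §I.14 (14.3)]
[cite: Washington1997, §7.1] -/
theorem charIdeal_eq_span_of_mem_charIdeal_of_bsd
    (hEC : Summit.BirchSwinnertonDyer.Rank1Residual.X5.O1.TwoAdicEulerCharRankZero W 0)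
    (hord : IsOrdinaryAt W 2) (hL : W.entireLFunction 1 ≠ 0) (hfin : Finite W.sha)
    {κ : ZpExtension ℚ 2} {γ : Field.absoluteGaloisGroup ℚ}
    (hκ : κ.IsCyclotomic) (hγ : κ.IsTopGenerator γ) (hγ' : IsCyclotomicVariable 2 γ)
    (hf : IsNewformOf W f) (D : W.SelmerDualData κ γ) (hX : D.IsTorsion) {ϖ : ℚ}
    (hϖ : (ϖ : ℝ) * W.realPeriodRat = plusPeriod f) {L₀ : IwasawaAlgebra 2}
    (hL₀ : iwasawaToPowerSeries 2 L₀ =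
      PowerSeries.C (ϖ : ℚ_[2]) * padicLFunction f (unitRoot W 2 : ℚ_[2]))
    (hmem : L₀ ∈ D.charIdeal)
    (hbsd : ∀ t : ℚ, W.entireLFunction 1 / (W.realPeriodRat : ℂ) = (t : ℂ) →
      padicValRat 2 t = (padicValNat 2 W.shaOrder : ℤ) + padicValNat 2 W.tamagawaProduct -
        2 * padicValNat 2 W.torsionOrder) :
    D.charIdeal = Ideal.span {L₀} := by
  -- Step 0: `ϖ ≠ 0`; `s = [0]⁺_f`, `t = ϖ·s = L(E,1)/Ω_E ≠ 0`
  have hΩpos : 0 < W.realPeriodRat := W.realPeriodRat_pos_holds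
  have hϖ0 : ϖ ≠ 0 := by
    rintro rfl
    have hper : 0 < plusPeriod f := IsNewform0.plusPeriod_pos_holds hf.1 hf.coeffField_eq_bot
    rw [← hϖ, Rat.cast_zero, zero_mul] at hper
    exact lt_irrefl _ hper
  set s : ℚ := ratPlusSymbol f 0 with hs_def
  set t : ℚ := ϖ * s with ht_def
  have hLval : W.entireLFunction 1 = (((s : ℝ) * plusPeriod f : ℝ) : ℂ) := hf.entireLFunction_one_eq
  have hq : W.entireLFunction 1 / (W.realPeriodRat : ℂ) = ((t : ℚ) : ℂ) := by
    rw [hLval, ← hϖ, div_eq_iff (Complex.ofReal_ne_zero.mpr hΩpos.ne'), ht_def]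
    push_cast
    ring
  have hs0 : s ≠ 0 := by
    intro h0
    apply hL
    rw [hLval, h0]
    simp
  have hvt : padicValRat 2 t = padicValRat 2 ϖ + padicValRat 2 s := by
    rw [ht_def, padicValRat.mul hϖ0 hs0]
  have hbsd' := hbsd t hq
  -- Step 1: the Iwasawa module, a generator `fE` of `char_Λ X`, the INTEGRAL relation `h·fE = L₀`
  haveI : Module.Finite (IwasawaAlgebra 2) D.X := D.module_finite_holds hγ
  obtain ⟨fE, hfE⟩ := (charIdeal_isPrincipal_holds 2 D.X).principal
  have hchar : D.charIdeal = Ideal.span {fE} := hfE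
  have hmem' : L₀ ∈ Ideal.span ({fE} : Set (IwasawaAlgebra 2)) := hchar ▸ hmem
  obtain ⟨h, hh⟩ := Ideal.mem_span_singleton'.mp hmem'
  -- Step 2 (interpolation): `L₀(0) = ϖ · (1 - α⁻¹)² · s`
  set a : ℚ_[2] := ((unitRoot W 2 : ℤ_[2]) : ℚ_[2]) with ha
  have hL0 : ((PowerSeries.constantCoeff L₀ : ℤ_[2]) : ℚ_[2]) =
      (ϖ : ℚ_[2]) * (1 - a⁻¹) ^ 2 * (s : ℚ_[2]) := by
    rw [← constantCoeff_iwasawaToPowerSeries 2 L₀, hL₀, map_mul, PowerSeries.constantCoeff_C,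
      constantCoeff_padicLFunction_unitRoot hord hf]
    ring
  obtain ⟨u₂, hu₂⟩ := exists_unit_one_sub_unitRoot_inv 2 W hord
  haveI : NeZero (2 : ℕ) := ⟨two_ne_zero⟩
  obtain ⟨u₃, hu₃⟩ := exists_unit_natCard_eq_mul_card_primaryComponent
    ((integralModelInt W).map (Int.castRingHom (ZMod 2))).toAffine.Point 2
  set Np : ℚ_[2] := (Nat.card (AddCommGroup.primaryComponent
    ((integralModelInt W).map (Int.castRingHom (ZMod 2))).toAffine.Point 2) : ℚ_[2]) with hNp
  have hNcount : (W.reductionPointCount 2 : ℚ_[2]) = ((u₃ : ℤ_[2]) : ℚ_[2]) * Np := by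
    rw [WeierstrassCurve.reductionPointCount, hNp]
    exact hu₃
  have hNp0 : Np ≠ 0 := by
    rw [hNp]
    exact_mod_cast Nat.card_pos.ne'
  have h1 : (1 - a⁻¹) = ((u₂ : ℤ_[2]) : ℚ_[2]) * ((u₃ : ℤ_[2]) : ℚ_[2]) * Np := by
    rw [hu₂, hNcount, mul_assoc]
  have hsQ0 : (s : ℚ_[2]) ≠ 0 := by exact_mod_cast hs0
  have hϖQ0 : (ϖ : ℚ_[2]) ≠ 0 := by exact_mod_cast hϖ0
  have hU0 : ((u₂ : ℤ_[2]) : ℚ_[2]) * ((u₃ : ℤ_[2]) : ℚ_[2]) ≠ 0 :=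
    mul_ne_zero (coe_units_ne_zero 2 u₂) (coe_units_ne_zero 2 u₃)
  have h20 : (2 : ℚ_[2]) ≠ 0 := two_ne_zero
  -- Step 3 (finiteness): `L₀(0) ≠ 0`, hence `fE(0) ≠ 0` (`L₀ = h·fE`), `Sel_{2^∞}(E/ℚ)` finite
  have hL0Q0 : ((PowerSeries.constantCoeff L₀ : ℤ_[2]) : ℚ_[2]) ≠ 0 := by
    rw [hL0, h1]
    exact mul_ne_zero (mul_ne_zero hϖQ0 (pow_ne_zero 2 (mul_ne_zero hU0 hNp0))) hsQ0
  have hL00 : PowerSeries.constantCoeff L₀ ≠ 0 := fun h0 => hL0Q0 (by rw [h0, PadicInt.coe_zero])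
  have hfE00 : PowerSeries.constantCoeff fE ≠ 0 := by
    intro h0
    apply hL00
    rw [← hh, map_mul, h0, mul_zero]
  have hSelfin : Finite (W.selmerGroupPInfty 2) :=
    D.finite_selmerGroupPInfty_of_constantCoeff_ne_zero W hγ hX fE hchar hfE00
  obtain ⟨hEfin, hShapfin⟩ := (W.finite_selmerGroupPInfty_iff 2).mp hSelfin
  haveI := hEfin; haveI := hShapfin; haveI := hSelfin; haveI : Finite W.sha := hfin
  -- Step 4 (Greenberg's Thm. 4.1 AT 2 — the hypothesis `hEC`, slot `δ = 0` — for the generator `fE`)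
  obtain ⟨u₁, hu₁⟩ := hEC hord κ γ hκ hγ hγ' D hX fE hchar hSelfin
  rw [add_zero, zpow_natCast] at hu₁
  obtain ⟨u₄, hu₄⟩ := exists_unit_torsionOrder_eq W 2
  obtain ⟨u₅, hu₅⟩ := exists_unit_natCard_eq_mul_card_primaryComponent W.sha 2
  have hSel : Nat.card (W.selmerGroupPInfty 2) = Nat.card (AddCommGroup.primaryComponent W.sha 2) :=
    W.natCard_selmerGroupPInfty_eq_natCard_primaryComponent_sha 2
  set v := padicValNat 2 W.tamagawaProduct with hv
  set Tp : ℚ_[2] := (Nat.card (AddCommGroup.primaryComponent W.toAffine.Point 2) : ℚ_[2]) with hTp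
  set Shp : ℚ_[2] := (Nat.card (AddCommGroup.primaryComponent W.sha 2) : ℚ_[2]) with hShp
  have hu₄' : (W.torsionOrder : ℚ_[2]) = ((u₄ : ℤ_[2]) : ℚ_[2]) * Tp := by
    rw [hu₄, hTp]
    congr 1
    exact_mod_cast natCard_primaryComponent_point_congr W 2 _ _
  have hSha : (W.shaOrder : ℚ_[2]) = ((u₅ : ℤ_[2]) : ℚ_[2]) * Shp := by
    rw [WeierstrassCurve.shaOrder, hShp]
    exact hu₅
  have hSel' : (Nat.card (W.selmerGroupPInfty 2) : ℚ_[2]) = Shp := by rw [hShp, hSel]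
  rw [hSel'] at hu₁
  have hTp0 : Tp ≠ 0 := by rw [hTp]; exact_mod_cast Nat.card_pos.ne'
  have hShp0 : Shp ≠ 0 := by rw [hShp]; exact_mod_cast Nat.card_pos.ne'
  have hv2 : (2 : ℚ_[2]).valuation = 1 := by
    have h2 : ((2 : ℕ) : ℚ_[2]).valuation = 1 := Padic.valuation_p
    rwa [Nat.cast_ofNat] at h2
  have hvT : Tp.valuation = (padicValNat 2 W.torsionOrder : ℤ) := by
    have h := congrArg Padic.valuation hu₄'
    rw [Padic.valuation_natCast, Padic.valuation_mul (coe_units_ne_zero 2 u₄) hTp0,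
      valuation_coe_units_eq_zero, zero_add] at h
    exact h.symm
  have hvS : Shp.valuation = (padicValNat 2 W.shaOrder : ℤ) := by
    have h := congrArg Padic.valuation hSha
    rw [Padic.valuation_natCast, Padic.valuation_mul (coe_units_ne_zero 2 u₅) hShp0,
      valuation_coe_units_eq_zero, zero_add] at h
    exact h.symm
  have hvalL : (((PowerSeries.constantCoeff L₀ : ℤ_[2]) : ℚ_[2])).valuation =
      padicValRat 2 ϖ + padicValRat 2 s + 2 * Np.valuation := by
    rw [hL0, h1, Padic.valuation_mul (mul_ne_zero hϖQ0 (pow_ne_zero 2 (mul_ne_zero hU0 hNp0))) hsQ0,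
      Padic.valuation_mul hϖQ0 (pow_ne_zero 2 (mul_ne_zero hU0 hNp0)), Padic.valuation_pow,
      Padic.valuation_mul hU0 hNp0,
      Padic.valuation_mul (coe_units_ne_zero 2 u₂) (coe_units_ne_zero 2 u₃),
      valuation_coe_units_eq_zero, valuation_coe_units_eq_zero, Padic.valuation_ratCast,
      Padic.valuation_ratCast]
    push_cast
    ring
  have hfEQ0 : ((PowerSeries.constantCoeff fE : ℤ_[2]) : ℚ_[2]) ≠ 0 := by
    intro h0
    exact hfE00 (PadicInt.coe_eq_zero.mp h0)
  have hvalF : (((PowerSeries.constantCoeff fE : ℤ_[2]) : ℚ_[2])).valuation + 2 * Tp.valuation =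
      v + 2 * Np.valuation + Shp.valuation := by
    have h := congrArg Padic.valuation hu₁
    rw [Padic.valuation_mul hfEQ0 (pow_ne_zero 2 hTp0), Padic.valuation_pow,
      Padic.valuation_mul (mul_ne_zero (mul_ne_zero (coe_units_ne_zero 2 u₁) (pow_ne_zero v h20))
        (pow_ne_zero 2 hNp0)) hShp0,
      Padic.valuation_mul (mul_ne_zero (coe_units_ne_zero 2 u₁) (pow_ne_zero v h20))
        (pow_ne_zero 2 hNp0),
      Padic.valuation_mul (coe_units_ne_zero 2 u₁) (pow_ne_zero v h20), valuation_coe_units_eq_zero,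
      Padic.valuation_pow, Padic.valuation_pow, hv2] at h
    push_cast at h ⊢
    linarith
  have hvaleq : (((PowerSeries.constantCoeff L₀ : ℤ_[2]) : ℚ_[2])).valuation =
      (((PowerSeries.constantCoeff fE : ℤ_[2]) : ℚ_[2])).valuation := by
    rw [hvT, hvS] at hvalF
    rw [hvalL]
    have : padicValRat 2 ϖ + padicValRat 2 s = padicValRat 2 t := hvt.symm
    linarith
  have hnorm : ‖PowerSeries.constantCoeff L₀‖ = ‖PowerSeries.constantCoeff fE‖ := by
    rw [PadicInt.norm_def, PadicInt.norm_def, Padic.norm_eq_zpow_neg_valuation hL0Q0,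
      Padic.norm_eq_zpow_neg_valuation hfEQ0, hvaleq]
  -- Step 5: the integral pinch of §1
  rw [hchar]
  exact (span_eq_span_of_mem_span_of_norm_constantCoeff_eq hmem' hfE00 hnorm).symm

/-! ## §3 Consumers: `MazurMainConjecture W 2` and the Eisenstein half from the Kato half + `BSDp W 2` -/

/-- **The `2`-adic cyclotomic main conjecture on a rank-`0` good-ordinary-at-`2` curve from the KATO
HALF and `BSD(E,2)`.** PUBLISHED inputs as hypotheses: modularity (`hmod`, `L(E,1) ≠ 0` at analytic
rank `0`), Gross–Zagier–Kolyvagin (`hGZK`, finiteness of `Ш`), Kato 17.4 (1) at `2` (`h17`, used ONLY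
for `X` torsion), Greenberg Thm. 4.1 at `2` (`hEC`); plus `BSDp W 2` and the Kato–Néron half
`X5.O1.MainConjectureLowerDivisibilityAtTwoOrd W` (OPEN off the α-go habitat; the item `OrdKatoHalfAtTwo`
asserts it on the whole class). No `λ`-certificate, no `hper₀`, no Prop-5.14 point, no isogeny transport.
[cite: Kato2004Asterisque, Thm. 17.4 (1) (p. 273)] [cite: GreenbergLNM1716, Thm. 4.1 (p. 102)]
[cite: Miller2011LMS, Def. 1.1] -/
theorem mazurMainConjecture_two_of_katoHalfAt_of_bsdp (hmod : nonempty_modularParametrizationData)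
    (hGZK : rank_eq_analyticRank_of_analyticRank_le_one)
    (h17 : ∀ [NeZero (W.conductorNorm ℤ)] (f : CuspForm (Gamma0 (W.conductorNorm ℤ)) 2),
      kato_divisibility_allPrimes W 2 (f := f))
    (hEC : Summit.BirchSwinnertonDyer.Rank1Residual.X5.O1.TwoAdicEulerCharRankZero W 0)
    (hgo : GoodOrd W 2) (hr : W.analyticRank = 0) (hbsd : BSDp W 2)
    (hK : Summit.BirchSwinnertonDyer.Rank1Residual.X5.O1.MainConjectureLowerDivisibilityAtTwoOrd W) :
    MazurMainConjecture W 2 := by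
  intro κ γ hκ hγ hγ' _ f hf ϖ hϖ D
  have hord : IsOrdinaryAt W 2 := hgo
  obtain ⟨L₀, hmem, hL₀⟩ := hK κ γ hκ hγ hγ' hord f hf ϖ hϖ D
  have hL : W.entireLFunction 1 ≠ 0 := entireLFunction_one_ne_zero_of_analyticRank_eq_zero hmod W hr
  obtain ⟨-, hfin⟩ := hGZK W (by rw [hr]; exact zero_le_one)
  -- `BSD(E,2)` as the valuation identity `ord₂ t = ord₂ #Ш + ord₂ ∏c − 2·ord₂ #E(ℚ)_tors`
  have hbsd' : ∀ t : ℚ, W.entireLFunction 1 / (W.realPeriodRat : ℂ) = (t : ℂ) →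
      padicValRat 2 t = (padicValNat 2 W.shaOrder : ℤ) + padicValNat 2 W.tamagawaProduct -
        2 * padicValNat 2 W.torsionOrder := by
    intro t ht
    obtain ⟨hmw0, hE, hfin', hshaAn⟩ :=
      Literature.NumberTheory.EllipticCurves.Wuthrich2014.shaAn_eq_of_L_one_div_eq hGZK W hL ht
    haveI := hE
    haveI := hfin'
    obtain ⟨q, hq, hv⟩ := missingPPartAt_of_bsdp W 2 hbsd
    have hqt : q = t * (Nat.card W.toAffine.Point : ℚ) ^ 2 / (W.tamagawaProduct : ℚ) := by
      have h := hq.symm.trans hshaAn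
      exact_mod_cast h
    have ht0 : t ≠ 0 := by
      rintro rfl
      apply hL
      have hΩ : (W.realPeriodRat : ℂ) ≠ 0 := by exact_mod_cast W.realPeriodRat_pos_holds.ne'
      rw [Rat.cast_zero, div_eq_zero_iff] at ht
      exact ht.resolve_right hΩ
    have hc0 : (Nat.card W.toAffine.Point : ℚ) ≠ 0 := by exact_mod_cast Nat.card_pos.ne'
    have hTam0 : (W.tamagawaProduct : ℚ) ≠ 0 := by exact_mod_cast W.tamagawaProduct_pos'.ne'
    have htors : W.torsionOrder = Nat.card W.toAffine.Point := W.torsionOrder_eq_natCard_of_finite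
    rw [hqt, padicValRat.div (mul_ne_zero ht0 (pow_ne_zero 2 hc0)) hTam0,
      padicValRat.mul ht0 (pow_ne_zero 2 hc0), padicValRat.pow, padicValRat.of_nat,
      padicValRat.of_nat, ← htors] at hv
    simp only [Nat.cast_ofNat] at hv
    linarith
  -- `X` torsion: Kato 17.4 (1) at `2`
  haveI : Module.Finite (IwasawaAlgebra 2) D.X := D.module_finite_holds hγ
  obtain ⟨fE, hfE⟩ := (charIdeal_isPrincipal_holds 2 D.X).principal
  obtain ⟨hX, -⟩ :=
    Summit.BirchSwinnertonDyer.Rank1Residual.X5.O1.MuZeroUpgrade.exists_mul_charGen_eq_of_kato_allPrimes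
      W 2 (h17 f) hκ hγ hγ' hord hf D hfE hL₀
  exact ⟨hX, L₀, charIdeal_eq_span_of_mem_charIdeal_of_bsd W hEC hord hL hfin hκ hγ hγ' hf D hX hϖ
    hL₀ hmem hbsd', hL₀⟩

/-- **On a rank-`0` good-ordinary-at-`2` curve carrying PRINT + `BSD(E,2)`, the Kato half IS the
`2`-adic main conjecture** (⇐ is the landed bookkeeping
`X5.O1.mainConjectureLowerDivisibilityAtTwoOrd_of_mazurMainConjecture`).
[cite: Kato2004Asterisque, Thm. 17.4 (1) (p. 273)] [cite: GreenbergLNM1716, Thm. 4.1 (p. 102)] -/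
theorem mazurMainConjecture_two_iff_katoHalfAt_of_bsdp (hmod : nonempty_modularParametrizationData)
    (hGZK : rank_eq_analyticRank_of_analyticRank_le_one)
    (h17 : ∀ [NeZero (W.conductorNorm ℤ)] (f : CuspForm (Gamma0 (W.conductorNorm ℤ)) 2),
      kato_divisibility_allPrimes W 2 (f := f))
    (hEC : Summit.BirchSwinnertonDyer.Rank1Residual.X5.O1.TwoAdicEulerCharRankZero W 0)
    (hgo : GoodOrd W 2) (hr : W.analyticRank = 0) (hbsd : BSDp W 2) :
    MazurMainConjecture W 2 ↔
      Summit.BirchSwinnertonDyer.Rank1Residual.X5.O1.MainConjectureLowerDivisibilityAtTwoOrd W :=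
  ⟨fun h => Summit.BirchSwinnertonDyer.Rank1Residual.X5.O1.mainConjectureLowerDivisibilityAtTwoOrd_of_mazurMainConjecture
      W (fun _ => h),
    mazurMainConjecture_two_of_katoHalfAt_of_bsdp W hmod hGZK h17 hEC hgo hr hbsd⟩

/-- **The Eisenstein (lower) half at `2` from the Kato half + `BSD(E,2)` on a rank-`0` good-ordinary
curve** (via `MazurMainConjecture W 2` and the landed bookkeeping
`X5.O1.mainConjectureEisensteinDivisibilityAtTwo_of_mazurMainConjecture`).
[cite: Kato2004Asterisque, Thm. 17.4 (1) (p. 273)] [cite: GreenbergLNM1716, Thm. 4.1 (p. 102)]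
[cite: SkinnerUrban2014, Conj. 3.6.8 (p. 45) (shape)] -/
theorem eisensteinAt_two_of_katoHalfAt_of_bsdp (hmod : nonempty_modularParametrizationData)
    (hGZK : rank_eq_analyticRank_of_analyticRank_le_one)
    (h17 : ∀ [NeZero (W.conductorNorm ℤ)] (f : CuspForm (Gamma0 (W.conductorNorm ℤ)) 2),
      kato_divisibility_allPrimes W 2 (f := f))
    (hEC : Summit.BirchSwinnertonDyer.Rank1Residual.X5.O1.TwoAdicEulerCharRankZero W 0)
    (hgo : GoodOrd W 2) (hr : W.analyticRank = 0) (hbsd : BSDp W 2)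
    (hK : Summit.BirchSwinnertonDyer.Rank1Residual.X5.O1.MainConjectureLowerDivisibilityAtTwoOrd W) :
    Summit.BirchSwinnertonDyer.Rank1Residual.X5.O1.MainConjectureEisensteinDivisibilityAtTwo W :=
  Summit.BirchSwinnertonDyer.Rank1Residual.X5.O1.mainConjectureEisensteinDivisibilityAtTwo_of_mazurMainConjecture
    W (fun _ => mazurMainConjecture_two_of_katoHalfAt_of_bsdp W hmod hGZK h17 hEC hgo hr hbsd hK)

/-- **PUB form** (every printed input a Literature named fact, Greenberg's slot discharged by the
parity-free fact `Greenberg1999.thm41_charValue_rankZero_anyPrime` via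
`X5.O1.twoAdicEulerCharRankZero_zero_of_greenberg`): Kato half + `BSDp W 2` ⇒ `MazurMainConjecture W 2`.
[cite: GreenbergLNM1716, Thm. 4.1 (p. 102), Lemmas 4.6/4.7/4.11] [cite: Kato2004Asterisque, Thm. 17.4 (1) (p. 273)] -/
theorem mazurMainConjecture_two_of_facts_of_katoHalfAt_of_bsdp
    (hmod : nonempty_modularParametrizationData)
    (hGZK : rank_eq_analyticRank_of_analyticRank_le_one)
    (h17 : ∀ [NeZero (W.conductorNorm ℤ)] (f : CuspForm (Gamma0 (W.conductorNorm ℤ)) 2),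
      kato_divisibility_allPrimes W 2 (f := f))
    (hGr : Greenberg1999.thm41_charValue_rankZero_anyPrime)
    (hgo : GoodOrd W 2) (hr : W.analyticRank = 0) (hbsd : BSDp W 2)
    (hK : Summit.BirchSwinnertonDyer.Rank1Residual.X5.O1.MainConjectureLowerDivisibilityAtTwoOrd W) :
    MazurMainConjecture W 2 :=
  mazurMainConjecture_two_of_katoHalfAt_of_bsdp W hmod hGZK h17
    (Summit.BirchSwinnertonDyer.Rank1Residual.X5.O1.twoAdicEulerCharRankZero_zero_of_greenberg W hGr)
    hgo hr hbsd hK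

end Curve

end Summit.BirchSwinnertonDyer.BirchSwinnertonDyer.Theorems.KatoHalfPinch

end
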